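import Summits.ResolutionOfSingularities.ResolutionOfSingularities.Theorems.HomologicalConductorNoZenoRNormalStagesOfQuadraticNormal
import Literature.AlgebraicGeometry.Resolution.Lipman1969QuadraticTransformNormal
import HarnessLib

/-!
# Crux `NoZenoR` (stmt-ResolutionOfSingularities-19943) — the W3 print `Lipman1969_4_1` from the print «Lipman (8.1)»:
# `Lipman1969_4_1 ⟸ Lipman1969_8_1`, a door of record without the contraction theorem (27.1)

Route `ResolutionOfSingularities/HomologicalConductor` (cell decomp-res, hand leafhand-res-homologicalconduct-21 g0).
OURS: AI-written bookkeeping, weaker than expert review; nothing here is a statement of the manuscript under review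
(Hironaka 2017).  SUPPORT level, counted 0.  Def-free.  It consumes the NAMED FACT `Lipman1969_8_1` (Lipman 1969,
Proposition (8.1), local form; `Literature/AlgebraicGeometry/Resolution/Lipman1969QuadraticTransformNormal`) and proves
the print `Lipman1969_4_1.{0}` from it by this hand's assembly of Lipman's own proof of Theorem (4.1) (`…NormalStagesOfQuadraticNormal.Lipman1969_4_1_of_quadraticNormal`).
The result is CONDITIONAL on the named fact (a `conditional-result`); it replaces, for the crux chain's debt
`Lipman1969_4_1`, the door through `Lipman1969_27_1_reg_rat` (Castelnuovo, XL) by the door through (8.1) (complete ideals,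
§§5–8 of the paper; XL but purely local commutative algebra: "`𝔪ⁿ` is complete and the Rees ring `⊕ 𝔪ⁿ` is normal").

No crux, kill test or summit statement is proved here; resolution in positive characteristic is NOT proved.

References: J. Lipman, *Rational singularities, with applications to algebraic surfaces and unique factorization*, Publ.
Math. IHÉS 36 (1969): Proposition (8.1) (p. 212), Theorem (4.1) (p. 204) [`Lipman1969`].
-/

noncomputable section

-- single-problem summit: the doubled namespace component `ResolutionOfSingularities` is forced
set_option linter.dupNamespace false

open CategoryTheory AlgebraicGeometry TopologicalSpace IsLocalRing
open Literature.AlgebraicGeometry.Resolution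

namespace Summit.ResolutionOfSingularities.ResolutionOfSingularities.Theorems.NoZeno.QuadraticTransform

/-- **`Lipman1969_4_1 ⟸ Lipman1969_8_1`** (universe `0`): the minimal desingularization of a normal surface with finitely
many rational singular points exists, GIVEN Proposition (8.1) — by Lipman's own proof of Theorem (4.1) ((*) / Prop. (3.1),
blow up singular points, termination by exceptional-curve count; this hand's files `…QuadraticTransform*`,
`…MinimalResolutionOfNormalStages`, `…NormalStagesOfQuadraticNormal`) and hand 16 g4's globalisation
`GlobalResolution.Lipman1969_4_1_of_localMinimalBlowup`.  No contraction theorem (27.1) is used.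
[cite: Lipman1969, Theorem (4.1) and its proof (pp. 204–205); Proposition (8.1) (p. 212)] -/
theorem Lipman1969_4_1_of_8_1 (h81 : Lipman1969_8_1.{0}) : Lipman1969_4_1.{0} :=
  Lipman1969_4_1_of_quadraticNormal fun R _ _ _ _ _ h2 hR => h81 R h2 hR

/-- **The consumed local form from (8.1)**: a two-dimensional normal Noetherian local domain with a rational singularity has
a minimal desingularization of `Spec S` which is a blowing up along a centre cosupported at the closed point.
[cite: Lipman1969, Theorem (4.1) (p. 204); Proposition (8.1) (p. 212)] -/
theorem exists_isMinimalResolution_isBlowup_of_8_1 (h81 : Lipman1969_8_1.{0}) {S : Type} [CommRing S]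
    [IsNoetherianRing S] [IsLocalRing S] [IsDomain S] [IsIntegrallyClosed S] (hdim : ringKrullDim S = 2)
    (hrat : HasRationalSingularity S) :
    ∃ (X₀ : Scheme.{0}) (f : X₀ ⟶ Spec (.of S)) (J : (Spec (.of S)).IdealSheafData),
      IsMinimalResolution f ∧ IsBlowup f J ∧ (J.support : Set (Spec (.of S))) ⊆ {closedPoint S} :=
  exists_isMinimalResolution_isBlowup_of_quadraticNormal (fun R _ _ _ _ _ h2 hR => h81 R h2 hR) hdim hrat

end Summit.ResolutionOfSingularities.ResolutionOfSingularities.Theorems.NoZeno.QuadraticTransform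

end
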